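import Literature.AlgebraicGeometry.Motives.JacobianGaloisDescent
import Literature.AlgebraicGeometry.Motives.AbelianVarietyBaseChangeTowerFst
import HarnessLib

/-!
# Base change of SEMILINEAR automorphisms along a further extension of scalars
# («`ρ ⊠ σ`»: Görtz–Wedhorn I §(14.20), (4.8); Weil's descent bookkeeping)

Topic `AlgebraicGeometry/Motives`; namespace `Literature.AlgebraicGeometry.Motives.GaloisDescent` (the namespace of
`GaloisDescent.bc`, `GaloisDescent.gal` of `Motives/JacobianGaloisDescent`).  Definitions by explicit formula + theorems; no
named fact, no instance, no `sorry` (net Literature debt 0).  Cell `hodgecm-mathlib`, row I-6 ([Deligne1971TravauxShimura]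
Prop. 5.10), piece D0 of the lead's plan (A-p08, 2026-08-28): the bookkeeping that relates a semilinear Galois action on an
`L`-scheme (the currency of `GaloisDescentScheme`, finite layer `L / k`) to automorphisms of its base change to a bigger field `Ω`
(the currency of the complex layer, `Ω = ℂ`).

## Content

Let `k → L → Ω` be fields (`[Algebra k L] [Algebra L Ω]`), `Y` an `L`-scheme, `γ ∈ Aut(L/k)` and `σ : Ω ≃+* Ω` a ring automorphism
EXTENDING `γ` (`σ (x·1) = γ(x)·1` for `x ∈ L`).  A `γ`-SEMILINEAR endomorphism of `Y` is a morphism of schemes `ρ : Y → Y` covering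
`Spec γ⁻¹ : Spec L → Spec L` (`ρ ≫ (Y → Spec L) = (Y → Spec L) ≫ Spec γ⁻¹`, the convention of `GaloisDescent.gal = 1 × Spec γ⁻¹`).  Then

* `twistBC Ω Y γ σ hσ ρ hρ : Y ×_L Spec Ω ⟶ Y ×_L Spec Ω` — the morphism `ρ × Spec σ⁻¹` («`ρ ⊠ σ`»), a `σ`-semilinear endomorphism of
  the base change (`twistBC_fst`, `twistBC_snd`);
* `twistBC_id_eq_gal` — for `ρ = 𝟙`, `γ = 1` and `σ ∈ Aut(Ω/L)` it IS the Galois automorphism `gal σ = 1 × Spec σ⁻¹` of `Y ×_L Spec Ω`;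
* `twistBC_comp` — multiplicativity: `(ρ₂ ⊠ σ₂) ≫ (ρ₁ ⊠ σ₁) = (ρ₂ ≫ ρ₁) ⊠ (σ₁ ∘ σ₂)`;
* `eq_of_twistBC_eq` — FAITHFULNESS: `ρ ⊠ σ = ρ′ ⊠ σ` forces `ρ = ρ′` (the projection `Y ×_L Spec Ω → Y` is flat and surjective,
  hence an epimorphism of schemes) — and its two-object form `comp_eq_comp_of_twistBC` for intertwining relations;
* `twistBC_naturality` — for an `L`-morphism `f : Y → Y′` intertwining `ρ` and `ρ′`, `f ⊗ Ω` intertwines `ρ ⊠ σ` and `ρ′ ⊠ σ`;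
* `twistBC_gal_tower` — TOWER: for `Y = Y′ ⊗_{k′} L` the base change of a `k′`-scheme (`k′ → L → Ω` a tower) and `ρ = gal γ` the
  Galois automorphism of `Y′ ⊗_{k′} L` (`γ ∈ Aut(L/k′)`), `gal γ ⊠ σ` is the Galois automorphism `gal σ` of `Y′ ⊗_{k′} Ω` read through
  the tower isomorphism `(Y′ ⊗_{k′} L) ⊗_L Ω ≅ Y′ ⊗_{k′} Ω` (`AbelianVariety.bcFunctorTowerIso`).

These are the identities behind «the descended model's Galois action is the prescribed one» in every effective-descent
argument (Görtz–Wedhorn I §(14.20)–(14.21); Serre, *Algebraic Groups and Class Fields* V §20; the use in [Deligne1971TravauxShimura]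
Lemme 5.10.1).  HC_CM is proved only modulo the 7 printed citations until rung 0 closes; this file proves no cell binder.

## References
* [GortzWedhorn2020] U. Görtz, T. Wedhorn, *Algebraic Geometry I* (2nd ed. 2020), §(4.8), Prop. 4.16, §(14.20)–(14.21), Thm. 14.72 (1).
* [Deligne1971TravauxShimura] P. Deligne, *Travaux de Shimura*, Sém. Bourbaki 389 (1971), Lemme 5.10.1 (p. 158).
-/

noncomputable section

universe u

open CategoryTheory CategoryTheory.Limits AlgebraicGeometry

namespace Literature.AlgebraicGeometry.Motives

namespace GaloisDescent

open AbelianVariety (bcSpec bcFunctor specAut specAut_mul specAut_one specAut_comp_bcSpec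
  specAut_comp_specAut_symm specAut_symm_comp_specAut bcFunctorTowerIso bcSpec_comp_bcSpec_of_isScalarTower)

set_option backward.isDefEq.respectTransparency false

variable {k : Type u} [Field k] {L : Type u} [Field L] [Algebra k L] (Ω : Type u) [Field Ω] [Algebra L Ω]

/-! ### §0. Bookkeeping: `Spec` of inverses, projections of base-changed morphisms -/

section Bookkeeping

/-- `Spec σ⁻¹` for an algebra automorphism `σ` is `Spec` of the inverse RING automorphism (same morphism of schemes; the group
inverse of `Ω ≃ₐ[K] Ω` is `symm`). [cite: GortzWedhorn2020, §(14.20)] -/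
theorem specAut_inv_eq_specMap_symm {K : Type u} [Field K] [Algebra K Ω] (σ : Ω ≃ₐ[K] Ω) :
    specAut Ω σ⁻¹ = Spec.map (CommRingCat.ofHom ((σ : Ω ≃+* Ω).symm : Ω →+* Ω)) := by
  change Spec.map _ = Spec.map _
  congr 2

variable {Y Y' : SchemeOver L} (f : Y ⟶ Y')

/-- `(f ⊗ Ω) ≫ pr_{Y′} = pr_Y ≫ f` (Mathlib `Over.pullback_map_left`). [cite: GortzWedhorn2020, §(4.8) and Prop. 4.16] -/
@[reassoc]
theorem bcMap_left_fst :
    ((bcFunctor L Ω).map f).left ≫ pullback.fst Y'.hom (bcSpec L Ω) = pullback.fst Y.hom (bcSpec L Ω) ≫ f.left := by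
  simp only [Over.pullback_map_left, pullback.lift_fst]

/-- `(f ⊗ Ω) ≫ pr = pr` on the `Spec Ω` factor. [cite: GortzWedhorn2020, §(4.8) and Prop. 4.16] -/
@[reassoc]
theorem bcMap_left_snd :
    ((bcFunctor L Ω).map f).left ≫ pullback.snd Y'.hom (bcSpec L Ω) = pullback.snd Y.hom (bcSpec L Ω) := by
  simp only [Over.pullback_map_left, pullback.lift_snd]

end Bookkeeping

/-! ### §1. The twisted base change `ρ ⊠ σ = ρ × Spec σ⁻¹` -/

section Twist

variable (Y : SchemeOver L)

/-- `Spec σ⁻¹ : Spec Ω → Spec Ω` covers `Spec γ⁻¹ : Spec L → Spec L` when `σ` extends `γ` along `L → Ω`.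
[cite: GortzWedhorn2020, §(14.20)] -/
theorem specMap_symm_comp_bcSpec (γ : L ≃ₐ[k] L) (σ : Ω ≃+* Ω)
    (hσ : ∀ x : L, σ (algebraMap L Ω x) = algebraMap L Ω (γ x)) :
    Spec.map (CommRingCat.ofHom (σ.symm : Ω →+* Ω)) ≫ bcSpec L Ω = bcSpec L Ω ≫ specAut L γ⁻¹ := by
  change Spec.map _ ≫ Spec.map _ = Spec.map _ ≫ Spec.map _
  rw [← Spec.map_comp, ← Spec.map_comp, ← CommRingCat.ofHom_comp, ← CommRingCat.ofHom_comp]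
  congr 2
  refine RingHom.ext fun x => ?_
  change σ.symm (algebraMap L Ω x) = algebraMap L Ω ((γ⁻¹ : L ≃ₐ[k] L) x)
  rw [RingEquiv.symm_apply_eq, hσ, AlgEquiv.aut_inv, AlgEquiv.apply_symm_apply]

/-- **`ρ ⊠ σ := ρ × Spec σ⁻¹ : Y ×_L Spec Ω → Y ×_L Spec Ω`** — the base change to `Ω`, twisted by the extension `σ` of `γ`, of a
`γ`-semilinear endomorphism `ρ` of the `L`-scheme `Y` (`ρ` covers `Spec γ⁻¹`).  For `ρ = 𝟙`, `γ = 1` this is the Galois automorphism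
`gal σ` (`twistBC_id_eq_gal`). [cite: GortzWedhorn2020, §(14.20) and §(4.8)] -/
def twistBC (γ : L ≃ₐ[k] L) (σ : Ω ≃+* Ω) (hσ : ∀ x : L, σ (algebraMap L Ω x) = algebraMap L Ω (γ x))
    (ρ : Y.left ⟶ Y.left) (hρ : ρ ≫ Y.hom = Y.hom ≫ specAut L γ⁻¹) : bc Ω Y ⟶ bc Ω Y :=
  pullback.map Y.hom (bcSpec L Ω) Y.hom (bcSpec L Ω) ρ (Spec.map (CommRingCat.ofHom (σ.symm : Ω →+* Ω)))
    (specAut L γ⁻¹) hρ.symm (specMap_symm_comp_bcSpec Ω γ σ hσ).symm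

variable (γ : L ≃ₐ[k] L) (σ : Ω ≃+* Ω) (hσ : ∀ x : L, σ (algebraMap L Ω x) = algebraMap L Ω (γ x))
  (ρ : Y.left ⟶ Y.left) (hρ : ρ ≫ Y.hom = Y.hom ≫ specAut L γ⁻¹)

/-- `(ρ ⊠ σ) ≫ pr_Y = pr_Y ≫ ρ`. [cite: GortzWedhorn2020, §(14.20)] -/
@[reassoc]
theorem twistBC_fst :
    twistBC Ω Y γ σ hσ ρ hρ ≫ pullback.fst Y.hom (bcSpec L Ω) = pullback.fst Y.hom (bcSpec L Ω) ≫ ρ :=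
  pullback.lift_fst _ _ _

/-- `(ρ ⊠ σ) ≫ pr = pr ≫ Spec σ⁻¹`: `ρ ⊠ σ` is `σ`-semilinear over `Spec Ω`. [cite: GortzWedhorn2020, §(14.20)] -/
@[reassoc]
theorem twistBC_snd :
    twistBC Ω Y γ σ hσ ρ hρ ≫ pullback.snd Y.hom (bcSpec L Ω) =
      pullback.snd Y.hom (bcSpec L Ω) ≫ Spec.map (CommRingCat.ofHom (σ.symm : Ω →+* Ω)) :=
  pullback.lift_snd _ _ _

/-- The projection `Y ×_L Spec Ω → Y` is an epimorphism of schemes (flat and surjective base change of `Spec Ω → Spec L`).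
[cite: GortzWedhorn2020, Thm. 14.72 (1)] -/
theorem epi_fst : Epi (pullback.fst Y.hom (bcSpec L Ω)) := by
  haveI : Flat (pullback.fst Y.hom (bcSpec L Ω)) := MorphismProperty.pullback_fst _ _ inferInstance
  haveI : Surjective (pullback.fst Y.hom (bcSpec L Ω)) :=
    MorphismProperty.pullback_fst _ _ ⟨fun _ ↦ ⟨Classical.arbitrary _, Subsingleton.elim _ _⟩⟩
  exact Flat.epi_of_flat_of_surjective _

/-- **Faithfulness**: two `γ`-semilinear endomorphisms with the same twisted base change `ρ ⊠ σ = ρ′ ⊠ σ` are equal.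
[cite: GortzWedhorn2020, Thm. 14.72 (1)] -/
theorem eq_of_twistBC_eq {ρ ρ' : Y.left ⟶ Y.left} (hρ : ρ ≫ Y.hom = Y.hom ≫ specAut L γ⁻¹)
    (hρ' : ρ' ≫ Y.hom = Y.hom ≫ specAut L γ⁻¹)
    (h : twistBC Ω Y γ σ hσ ρ hρ = twistBC Ω Y γ σ hσ ρ' hρ') : ρ = ρ' := by
  haveI := epi_fst Ω Y
  have h' := congrArg (· ≫ pullback.fst Y.hom (bcSpec L Ω)) h
  simp only [twistBC_fst] at h'
  exact (cancel_epi _).mp h'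

/-- `𝟙 ⊠ σ = gal σ` for `σ ∈ Aut(Ω/L)` (`γ = 1`): the untwisted case is the Galois automorphism `1 × Spec σ⁻¹` of
`Motives/JacobianGaloisDescent`. [cite: GortzWedhorn2020, §(14.20)] -/
theorem twistBC_id_eq_gal (σ : Ω ≃ₐ[L] Ω)
    (hσ : ∀ x : L, (σ : Ω ≃+* Ω) (algebraMap L Ω x) = algebraMap L Ω ((1 : L ≃ₐ[k] L) x))
    (hid : 𝟙 Y.left ≫ Y.hom = Y.hom ≫ specAut L (1 : L ≃ₐ[k] L)⁻¹) :
    twistBC Ω Y 1 (σ : Ω ≃+* Ω) hσ (𝟙 Y.left) hid = gal Ω Y σ := by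
  apply pullback.hom_ext
  · rw [twistBC_fst, gal_fst, Category.comp_id]
  · rw [twistBC_snd, gal_snd, specAut_inv_eq_specMap_symm]

/-- **Multiplicativity**: `(ρ₂ ⊠ σ₂) ≫ (ρ₁ ⊠ σ₁) = (ρ₂ ≫ ρ₁) ⊠ (σ₁ ∘ σ₂)` — composites of semilinear endomorphisms are
semilinear for the product, and `⊠` respects this (orientation as `gal_mul`: `gal (σ τ) = gal τ ≫ gal σ`).
[cite: GortzWedhorn2020, §(14.20)] -/
theorem twistBC_comp (γ₁ γ₂ : L ≃ₐ[k] L) (σ₁ σ₂ : Ω ≃+* Ω)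
    (hσ₁ : ∀ x : L, σ₁ (algebraMap L Ω x) = algebraMap L Ω (γ₁ x))
    (hσ₂ : ∀ x : L, σ₂ (algebraMap L Ω x) = algebraMap L Ω (γ₂ x))
    (ρ₁ ρ₂ : Y.left ⟶ Y.left) (hρ₁ : ρ₁ ≫ Y.hom = Y.hom ≫ specAut L γ₁⁻¹) (hρ₂ : ρ₂ ≫ Y.hom = Y.hom ≫ specAut L γ₂⁻¹)
    (hσ₁₂ : ∀ x : L, (σ₂.trans σ₁) (algebraMap L Ω x) = algebraMap L Ω ((γ₁ * γ₂) x))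
    (hρ₁₂ : (ρ₂ ≫ ρ₁) ≫ Y.hom = Y.hom ≫ specAut L (γ₁ * γ₂)⁻¹) :
    twistBC Ω Y γ₂ σ₂ hσ₂ ρ₂ hρ₂ ≫ twistBC Ω Y γ₁ σ₁ hσ₁ ρ₁ hρ₁ =
      twistBC Ω Y (γ₁ * γ₂) (σ₂.trans σ₁) hσ₁₂ (ρ₂ ≫ ρ₁) hρ₁₂ := by
  apply pullback.hom_ext
  · rw [Category.assoc, twistBC_fst, twistBC_fst_assoc, twistBC_fst]
  · rw [Category.assoc, twistBC_snd, twistBC_snd_assoc, twistBC_snd, ← Spec.map_comp, ← CommRingCat.ofHom_comp]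
    rfl

/-- The semilinearity equations compose: if `ρᵢ` covers `Spec γᵢ⁻¹` then `ρ₂ ≫ ρ₁` covers `Spec (γ₁γ₂)⁻¹`. [cite: GortzWedhorn2020, §(14.20)] -/
theorem comp_semilinear (γ₁ γ₂ : L ≃ₐ[k] L) (ρ₁ ρ₂ : Y.left ⟶ Y.left) (hρ₁ : ρ₁ ≫ Y.hom = Y.hom ≫ specAut L γ₁⁻¹)
    (hρ₂ : ρ₂ ≫ Y.hom = Y.hom ≫ specAut L γ₂⁻¹) :
    (ρ₂ ≫ ρ₁) ≫ Y.hom = Y.hom ≫ specAut L (γ₁ * γ₂)⁻¹ := by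
  rw [Category.assoc, hρ₁, reassoc_of% hρ₂, mul_inv_rev, specAut_mul]

/-- The extension conditions compose: if `σᵢ` extends `γᵢ` then `σ₁ ∘ σ₂` extends `γ₁ γ₂`. [cite: GortzWedhorn2020, §(14.20)] -/
theorem trans_extends (γ₁ γ₂ : L ≃ₐ[k] L) (σ₁ σ₂ : Ω ≃+* Ω)
    (hσ₁ : ∀ x : L, σ₁ (algebraMap L Ω x) = algebraMap L Ω (γ₁ x))
    (hσ₂ : ∀ x : L, σ₂ (algebraMap L Ω x) = algebraMap L Ω (γ₂ x)) :
    ∀ x : L, (σ₂.trans σ₁) (algebraMap L Ω x) = algebraMap L Ω ((γ₁ * γ₂) x) := fun x => by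
  rw [RingEquiv.trans_apply, hσ₂, hσ₁, AlgEquiv.mul_apply]

/-- The identity is `1`-semilinear. [cite: GortzWedhorn2020, §(14.20)] -/
theorem id_semilinear : 𝟙 Y.left ≫ Y.hom = Y.hom ≫ specAut L (1 : L ≃ₐ[k] L)⁻¹ := by
  rw [inv_one, specAut_one, Category.id_comp, Category.comp_id]

end Twist

/-! ### §2. Naturality: `L`-morphisms intertwining semilinear endomorphisms -/

section Natural

variable {Y Y' : SchemeOver L} (γ : L ≃ₐ[k] L) (σ : Ω ≃+* Ω)
  (hσ : ∀ x : L, σ (algebraMap L Ω x) = algebraMap L Ω (γ x))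
  (ρ : Y.left ⟶ Y.left) (hρ : ρ ≫ Y.hom = Y.hom ≫ specAut L γ⁻¹)
  (ρ' : Y'.left ⟶ Y'.left) (hρ' : ρ' ≫ Y'.hom = Y'.hom ≫ specAut L γ⁻¹) (f : Y ⟶ Y')

/-- If the `L`-morphism `f : Y → Y′` intertwines `ρ` and `ρ′`, then `f ⊗ Ω` intertwines `ρ ⊠ σ` and `ρ′ ⊠ σ`.
[cite: GortzWedhorn2020, §(14.20)] -/
theorem twistBC_naturality (h : ρ ≫ f.left = f.left ≫ ρ') :
    twistBC Ω Y γ σ hσ ρ hρ ≫ ((bcFunctor L Ω).map f).left = ((bcFunctor L Ω).map f).left ≫ twistBC Ω Y' γ σ hσ ρ' hρ' := by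
  apply pullback.hom_ext
  · rw [Category.assoc, Category.assoc, bcMap_left_fst, twistBC_fst_assoc, twistBC_fst, bcMap_left_fst_assoc, h]
  · rw [Category.assoc, Category.assoc, bcMap_left_snd, twistBC_snd, twistBC_snd, bcMap_left_snd_assoc]

/-- Conversely (**faithfulness, two-object form**): if `f ⊗ Ω` intertwines `ρ ⊠ σ` and `ρ′ ⊠ σ`, then `f` intertwines `ρ` and `ρ′`.
[cite: GortzWedhorn2020, Thm. 14.72 (1)] -/
theorem comp_eq_comp_of_twistBC
    (h : twistBC Ω Y γ σ hσ ρ hρ ≫ ((bcFunctor L Ω).map f).left = ((bcFunctor L Ω).map f).left ≫ twistBC Ω Y' γ σ hσ ρ' hρ') :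
    ρ ≫ f.left = f.left ≫ ρ' := by
  haveI := epi_fst Ω Y
  have h' := congrArg (· ≫ pullback.fst Y'.hom (bcSpec L Ω)) h
  simp only [Category.assoc, bcMap_left_fst, twistBC_fst, twistBC_fst_assoc, bcMap_left_fst_assoc] at h'
  exact (cancel_epi _).mp h'

end Natural

/-! ### §3. Tower: the Galois automorphism of `Y′ ⊗_{k′} L`, twisted to `Ω`, is the Galois automorphism of `Y′ ⊗_{k′} Ω` -/

section Tower

variable (k' : Type u) [Field k'] [Algebra k' L] [Algebra k' Ω] [IsScalarTower k' L Ω] (Y' : SchemeOver k')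

/-- The Galois automorphism `gal γ` of `Y′ ⊗_{k′} L` (`γ ∈ Aut(L/k′)`) is `γ`-semilinear in the sense of §1 for any structure of
`k`-algebra on `L` making `γ` a `k`-automorphism. [cite: GortzWedhorn2020, §(14.20)] -/
theorem gal_semilinear (γ' : L ≃ₐ[k'] L) (γ : L ≃ₐ[k] L) (hγ : ∀ x, γ x = γ' x) :
    gal L Y' γ' ≫ ((bcFunctor k' L).obj Y').hom = ((bcFunctor k' L).obj Y').hom ≫ specAut L γ⁻¹ := by
  change gal L Y' γ' ≫ pullback.snd Y'.hom (bcSpec k' L) = pullback.snd Y'.hom (bcSpec k' L) ≫ specAut L γ⁻¹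
  rw [gal_snd]
  congr 1
  change Spec.map _ = Spec.map _
  congr 2
  refine RingHom.ext fun x => ?_
  change (γ'⁻¹ : L ≃ₐ[k'] L) x = (γ⁻¹ : L ≃ₐ[k] L) x
  rw [AlgEquiv.aut_inv, AlgEquiv.aut_inv, AlgEquiv.symm_apply_eq, ← hγ, AlgEquiv.apply_symm_apply]

/-- **Tower**: for `γ ∈ Aut(L/k′)` and a ring automorphism `σ` of `Ω` extending `γ` (hence fixing `k′`, `σ′ ∈ Aut(Ω/k′)`), the
twisted base change `gal γ ⊠ σ` of the Galois automorphism of `Y′ ⊗_{k′} L` is the Galois automorphism `gal σ′` of `Y′ ⊗_{k′} Ω`,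
read through the tower isomorphism `(Y′ ⊗_{k′} L) ⊗_L Ω ≅ Y′ ⊗_{k′} Ω` (`AbelianVariety.bcFunctorTowerIso`, characterised by its
projections: `AbelianVarietyBaseChangeTowerFst`). [cite: GortzWedhorn2020, Prop. 4.16, §(4.8) and §(14.20)] -/
theorem twistBC_gal_tower (γ' : L ≃ₐ[k'] L) (γ : L ≃ₐ[k] L) (hγ : ∀ x, γ x = γ' x) (σ' : Ω ≃ₐ[k'] Ω)
    (hσ : ∀ x : L, (σ' : Ω ≃+* Ω) (algebraMap L Ω x) = algebraMap L Ω (γ x)) :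
    twistBC Ω ((bcFunctor k' L).obj Y') γ (σ' : Ω ≃+* Ω) hσ (gal L Y' γ') (gal_semilinear k' Y' γ' γ hγ) ≫
        ((bcFunctorTowerIso k' L Ω).hom.app Y').left =
      ((bcFunctorTowerIso k' L Ω).hom.app Y').left ≫ gal Ω Y' σ' := by
  -- the tower isomorphism against the two projections of `Y' ×_{k'} Spec Ω`
  have hT₁ : ((bcFunctorTowerIso k' L Ω).hom.app Y').left ≫ pullback.fst Y'.hom (bcSpec k' Ω) =
      pullback.fst ((bcFunctor k' L).obj Y').hom (bcSpec L Ω) ≫ pullback.fst Y'.hom (bcSpec k' L) := by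
    rw [show bcFunctorTowerIso k' L Ω = (Over.pullbackComp (bcSpec L Ω) (bcSpec k' L)).symm ≪≫
      overPullbackCongr (bcSpec_comp_bcSpec_of_isScalarTower k' L Ω) from rfl]
    exact pullbackComp_symm_trans_congr_hom_app_left_comp_fst (bcSpec_comp_bcSpec_of_isScalarTower k' L Ω) Y'
  have hT₂ : ((bcFunctorTowerIso k' L Ω).hom.app Y').left ≫ pullback.snd Y'.hom (bcSpec k' Ω) =
      pullback.snd ((bcFunctor k' L).obj Y').hom (bcSpec L Ω) :=
    Over.w ((bcFunctorTowerIso k' L Ω).hom.app Y')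
  -- `gal γ' ≫ pr_{Y'} = pr_{Y'}` on `Y' ×_{k'} Spec L`
  have hg : gal L Y' γ' ≫ pullback.fst Y'.hom (bcSpec k' L) = pullback.fst Y'.hom (bcSpec k' L) := gal_fst L Y' γ'
  apply pullback.hom_ext
  · rw [Category.assoc, Category.assoc, hT₁, gal_fst, ← Category.assoc _ (pullback.fst _ _) (pullback.fst _ _),
      twistBC_fst, Category.assoc, hg, ← hT₁]
  · rw [Category.assoc, Category.assoc, hT₂, gal_snd, twistBC_snd, ← Category.assoc, hT₂, specAut_inv_eq_specMap_symm]

end Tower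

end GaloisDescent

end Literature.AlgebraicGeometry.Motives

end
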